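import Mathlib.Data.Fintype.Option
import Mathlib.LinearAlgebra.Pi
import Mathlib.Topology.Homotopy.Contractible
import Literature.AlgebraicTopology.SingularHomology.DisjointUnion
import Literature.AlgebraicTopology.SingularHomology.CohomologyOfPoint
import HarnessLib

/-!
# Singular cohomology of a finite discrete space

Topic `Literature/AlgebraicTopology/SingularHomology`. For a finite discrete space `D` and a
commutative ring `R` of coefficients:

* `isZero_singularCohomology_succ_of_finite_discrete` — `Hᵖ⁺¹(D; R) = 0` for every `p`;
* `nonempty_singularCohomology_zero_equiv_of_finite_discrete` — `H⁰(D; R) ≃ₗ[R] (D → R)`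
  (the `R`-module of functions on the finitely many points).

This is the additivity of singular cohomology over the (finitely many) points
(A. Hatcher, *Algebraic Topology* (2002), §3.1 p. 202: `Hⁿ(∐_α X_α; G) ≅ ∏_α Hⁿ(X_α; G)`)
combined with the cohomology of a point (loc. cit. p. 199: `H⁰(pt; G) = G`, `Hⁿ(pt; G) = 0` for
`n > 0`). Proof: induction on the finite type (`Finite.induction_empty_option`): the empty space
has no cochains, and `Option α ≃ₜ α ⊕ pt` for discrete `α`, so the tree's two-summand additivity
`singularCohomology.sumEquiv` and `singularCohomologyZeroEquiv` /
`isZero_singularCohomology_of_subsingleton'` (file `CohomologyOfPoint`) apply; homeomorphic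
spaces have isomorphic cohomology (`singularCohomology.mapIso`).

Written for the zero-dimensional case of Grothendieck's comparison theorem
(`Literature.AlgebraicGeometry.Motives.AffineAlgebraicDeRham`: the complex points of a finite
`ℂ`-scheme form a finite discrete subspace of `ℂⁿ`). Everything is proved; no named facts.

## References

* A. Hatcher, *Algebraic Topology*, CUP 2002, §3.1 pp. 199, 202. [HatcherAT2002]
-/

noncomputable section

open CategoryTheory CategoryTheory.Limits

universe u

namespace Literature.AlgebraicTopology.SingularHomology

variable (R : Type u) [CommRing R]

/-- The empty space has no cohomology in any degree (no singular simplices, so the cochain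
modules are trivial); coefficients in any universe-compatible ring. [folklore] -/
theorem isZero_singularCohomology_of_isEmpty' (Y : Type u) [TopologicalSpace Y] [IsEmpty Y]
    (p : ℕ) : IsZero (singularCohomology R R Y p) := by
  refine ShortComplex.isZero_homology_of_isZero_X₂ _ ?_
  change IsZero ((singularCochainComplex R R Y).X p)
  haveI : Subsingleton ((singularCochainComplex R R Y).X p) :=
    ⟨fun φ ψ => singularCochainComplex.ext fun σ => isEmptyElim σ⟩
  exact ModuleCat.isZero_of_subsingleton _

/-- The induction behind the computation: for every finite type `D` and every discrete topology
on it, `Hᵖ⁺¹(D; R) = 0` for all `p` and `H⁰(D; R) ≃ₗ[R] (D → R)`. (Induction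
`∅`, `Option α ≃ α ⊕ pt`, transport along bijections = homeomorphisms of discrete spaces.)
[cite: HatcherAT2002, §3.1 p. 202] -/
theorem singularCohomology_finite_discrete_aux (D : Type u) [Finite D] :
    ∀ (t : TopologicalSpace D), @DiscreteTopology D t →
      (∀ p : ℕ, IsZero (@singularCohomology R _ R _ _ D t (p + 1))) ∧
        Nonempty (@singularCohomology R _ R _ _ D t 0 ≃ₗ[R] (D → R)) := by
  refine Finite.induction_empty_option
    (P := fun D => ∀ (t : TopologicalSpace D), @DiscreteTopology D t →
      (∀ p : ℕ, IsZero (@singularCohomology R _ R _ _ D t (p + 1))) ∧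
        Nonempty (@singularCohomology R _ R _ _ D t 0 ≃ₗ[R] (D → R))) ?_ ?_ ?_ D
  · -- transport along a bijection
    intro α β e h tβ hβ
    letI tα : TopologicalSpace α := ⊥
    haveI hα : DiscreteTopology α := ⟨rfl⟩
    obtain ⟨h1, h2⟩ := h tα hα
    let e' : α ≃ₜ β :=
      { toEquiv := e
        continuous_toFun := continuous_of_discreteTopology
        continuous_invFun := continuous_of_discreteTopology }
    refine ⟨fun p => IsZero.of_iso (h1 p) (singularCohomology.mapIso (R := R) (M := R) e' (p + 1)),
      ⟨((singularCohomology.mapIso (R := R) (M := R) e' 0).toLinearEquiv.trans h2.some).trans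
        (LinearEquiv.funCongrLeft R R e.symm)⟩⟩
  · -- the empty space
    intro t _
    haveI : Subsingleton (@singularCohomology R _ R _ _ PEmpty t 0) :=
      ModuleCat.subsingleton_of_isZero (isZero_singularCohomology_of_isEmpty' R PEmpty 0)
    exact ⟨fun p => isZero_singularCohomology_of_isEmpty' R PEmpty (p + 1),
      ⟨LinearEquiv.ofSubsingleton _ _⟩⟩
  · -- adding one point
    intro α _ ih tO hO
    letI tα : TopologicalSpace α := ⊥
    haveI hα : DiscreteTopology α := ⟨rfl⟩
    obtain ⟨h1, h2⟩ := ih tα hα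
    let e : Option α ≃ₜ (α ⊕ PUnit.{u + 1}) :=
      { toEquiv := Equiv.optionEquivSumPUnit α
        continuous_toFun := continuous_of_discreteTopology
        continuous_invFun := continuous_of_discreteTopology }
    refine ⟨fun p => ?_, ?_⟩
    · haveI : Subsingleton (singularCohomology R R α (p + 1)) :=
        ModuleCat.subsingleton_of_isZero (h1 p)
      haveI : Subsingleton (singularCohomology R R PUnit.{u + 1} (p + 1)) :=
        ModuleCat.subsingleton_of_isZero
          (singularCochainComplex.isZero_singularCohomology_of_subsingleton' (R := R) (M := R)
            (X := PUnit.{u + 1}) (Nat.succ_ne_zero p))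
      haveI : Subsingleton (singularCohomology R R (α ⊕ PUnit.{u + 1}) (p + 1)) :=
        (singularCohomology.sumEquiv R R α PUnit.{u + 1} (p + 1)).toEquiv.subsingleton
      exact IsZero.of_iso (ModuleCat.isZero_of_subsingleton _)
        (singularCohomology.mapIso (R := R) (M := R) e (p + 1)).symm
    · let e₁ : singularCohomology R R (Option α) 0 ≃ₗ[R]
          singularCohomology R R (α ⊕ PUnit.{u + 1}) 0 :=
        (singularCohomology.mapIso (R := R) (M := R) e 0).symm.toLinearEquiv
      let e₂ : singularCohomology R R (α ⊕ PUnit.{u + 1}) 0 ≃ₗ[R] (α → R) × R :=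
        (singularCohomology.sumEquiv R R α PUnit.{u + 1} 0).trans
          (LinearEquiv.prodCongr h2.some (singularCohomologyZeroEquiv R R PUnit.{u + 1}))
      let e₃ : ((α → R) × R) ≃ₗ[R] (Option α → R) :=
        (LinearEquiv.prodComm R _ _).trans
          (LinearEquiv.piOptionEquivProd R (M := fun _ : Option α => R)).symm
      exact ⟨(e₁.trans e₂).trans e₃⟩

variable (D : Type u) [TopologicalSpace D] [DiscreteTopology D] [Finite D]

/-- **`Hᵖ⁺¹(D; R) = 0` for a finite discrete space `D`** (additivity over the points and
`Hⁿ(pt) = 0`, `n > 0`; Hatcher 2002, §3.1 pp. 199, 202). [cite: HatcherAT2002, §3.1 p. 202] -/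
theorem isZero_singularCohomology_succ_of_finite_discrete (p : ℕ) :
    IsZero (singularCohomology R R D (p + 1)) :=
  ((singularCohomology_finite_discrete_aux R D) _ ‹_›).1 p

/-- **`H⁰(D; R) ≅ R^D` for a finite discrete space `D`**: the functions on the points
(additivity over the points and `H⁰(pt) = R`; Hatcher 2002, §3.1 pp. 199, 202).
[cite: HatcherAT2002, §3.1 p. 202] -/
theorem nonempty_singularCohomology_zero_equiv_of_finite_discrete :
    Nonempty (singularCohomology R R D 0 ≃ₗ[R] (D → R)) :=
  ((singularCohomology_finite_discrete_aux R D) _ ‹_›).2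

/-- In particular `Hᵖ⁺¹(D; R)` has a single element. [folklore] -/
theorem subsingleton_singularCohomology_succ_of_finite_discrete (p : ℕ) :
    Subsingleton (singularCohomology R R D (p + 1)) :=
  ModuleCat.subsingleton_of_isZero (isZero_singularCohomology_succ_of_finite_discrete R D p)

end Literature.AlgebraicTopology.SingularHomology

end
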